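import Literature.MathematicalPhysics.QuantumFieldTheory.Balaban1983to89.B2Eq2108FormSplit

/-!
# `Balaban1983to89.B2Eq2108ErrorBound` — [Balaban1982Higgs2] **(2.108)** p. 580, the ERROR TERM: the size
# `O(1)e^{−δ₁r(Lᵏε)}·t²·|Λ₃^{(k)}| ≤ O((Lᵏε)^κ)|Λ₃^{(k)}|` of `½⟨Λ₆^{(k−1)′}φ, H_kΛ₆^{(k−1)′}φ⟩` under `|φ| ≤ t`, for the
# CONCRETE `H_k` of `B2Ineq2109RegularField` (covariant `Δ^{(k)}(Ω,B̃)` at a regular field), by `x`-dependent damping + lattice sums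

statement-level skeleton of published theorems with citation tags; proofs where landed; nothing here is a claim about the Yang–Mills mass gap

PDF held: `paper:balaban1982-cmp86-higgs23-ii` (T. Bałaban, *(Higgs)₂,₃ quantum fields in a finite volume. II. An upper
bound*, Commun. Math. Phys. **86** (1982) 555–594 [Balaban1982Higgs2]; journal page = PDF page + 554); p. 580 [PDF 26] READ
AS AN IMAGE on `run/shared/lean/pub/pub-balaban/b2b-balaban-ref1/pages/1982-cmp86-higgs23-II/1982-cmp86-higgs23-II-p026-x2.png`
(also p. 558 [PDF 4] for (2.7)–(2.8), p. 570 [PDF 16] for (2.55); v1.2 (this seat's gen 17): the p. 580 quotation below re-keyed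
sentence by sentence on the render and the `φ`-restriction re-keyed to (2.55) p. 570 — docstring-only change, every declaration
byte-identical; v1.3 (this seat's gen 18): §6 appended — the `φ`-restriction of (2.55)₄ with `λ(·)` the FUNCTION `λ(ε) = λε^{4−d}`
of p. 557 [PDF 3] last line (render `…-p003-x2.png` re-read: (2.2) «|φ(x)| > (1/(λε^{4−d})^{1/4})p(ε)», (2.5), «where
λ(ε) = λε^{4−d}»; p. 570 render `…-p016-x2.png`: «|φ(x)| ≤ (c₁/λ(L^{k−1}ε)^{1/4})p(L^{k−1}ε) for x ∈ Λ₋₁^{(k−1)′}»), i.e. the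
general-`d` exponent `(4−d)/4` — second-reader note S-B2-r14g16-1 (r14 gen 16, SECONDREAD-B2 v41); §§1–5 declarations
byte-identical, one HONEST SCOPE sentence corrected).

CITATION HEADER (lean-in-tree rule).  Cell `lit-balaban` (HOME `run/shared/lean/pub/lit-balaban/`), Phase-2 proof seat **p23**
gen 7 (unit `lit-balaban-p23-g7`); SKELETON row **B2.Eq2.109** ((2.108)–(2.109) p. 580; fold owner r02, second reader r14,
referee ref-4); third companion of `B2Ineq2109RegularField` (p260028: `Inst`, `Adm`, `Hk`, the block lemmas `hk_PP/…/hk_33`,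
`DΩ_sub_D1/DΩ_sub_D2/DΩ_eq`, `abs_deltaK_entry_le`, `abs_deltaK_entry_sub_le`, `le_distOc`) and `B2Eq2108FormSplit` (p261040:
`eq2108`), and of r14's `B2StepK` (`rDecayBeatsPowers_of_printed`: `e^{−δ₁r(Lᵏε)} ≤ C_κ(Lᵏε)^κ` in the printed ranges) and p17's
`B4Cor23RegularWindow.prop22Small_regularPairW` (Proposition I.2.2 for the concrete operators) — all used BY NAME.

WHAT IS PRINTED (p. 580 [PDF 26]; the printed sentences, quoted from the render).  Before (2.108): *"We will localize this
form in the set Λ₆^{(k−1)′}∩Λ₃^{(k)c}, Λ₃^{(k)}, and we will change the operators of the forms using Proposition I.2.2 and the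
restrictions on the fields ψ, φ. We have"* — display (2.108), whose last line is *"+ O((Lᵏε)^κ)|Λ₃^{(k)}|."*  After (2.108): *"More
exactly the difference between the quadratic forms is a quadratic form ½⟨Λ₆^{(k−1)′}φ, H_kΛ₆^{(k−1)′}φ⟩ and for the matrix elements
h_k(x, x′) of the operator H_k of this form, the following inequality holds |h_k(x, x′)| ≤ O(1)exp(−δ₁r(Lᵏε))exp(−δ₀|x − x′|)
≤ O((Lᵏε)^κ)exp(−δ₀|x − x′|) (2.109) for x, x′ ∈ Λ₆^{(k−1)′} and arbitrary κ."*  READING (ours, not a printed sentence): the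
kernel bound (2.109), for `κ` arbitrarily large but fixed, summed against the restricted field `φ` is what produces the last term of
(2.108).  The restriction used: *"|φ(x)| ≤ c₁λ(L^{k−1}ε)^{−1/4}p(L^{k−1}ε) for x ∈ Λ₋₁^{(k−1)′}"* — the characteristic functions `χ_k`,
(2.55) p. 570 [PDF 16] (`Λ₆^{(k−1)′} ⊂ Λ₋₁^{(k−1)′}`); `p(ε) = b₀(1 + log ε⁻¹)^p` (p. 557), `r(ε) = R(1 + log ε⁻¹)^r` with `R > R₀` (2.7).

WHY A THIRD FILE.  Summing the uniform kernel bound (2.109) over `x, x′ ∈ Λ₆^{(k−1)′}` gives `O((Lᵏε)^κ)|Λ₆^{(k−1)′}|`, not the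
printed `|Λ₃^{(k)}|` (`Λ₆′ ⊃ Λ₃` may be much larger).  The printed volume factor comes from WHERE `h_k` lives: by the block
structure of `H_k` (companion file) `h_k(x,x′)` vanishes unless `x` or `x′` lies in `Λ₄^{(k)} ⊂ Λ₃^{(k)}` or the entry is a
`Δ(Ω) − Δ(Ω₁)` difference, and Proposition I.2.2 (2.29) damps that difference by `e^{−δ₀dist(x, Ω∖Ω₁)}` with `Ω∖Ω₁ = B(Λ₅^{(k)})`,
`Λ₅ ⊂ Λ₃` — an `x`-DEPENDENT factor whose lattice sum is `O(1)|Λ₅|e^{−δ₀r/2}`.  This file proves exactly that.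

WHAT IS KERNEL-CHECKED (zero `sorry`, no new `def … : Prop`; axioms standard).
 §1 lattice sums [folklore, private]: `Σ_{x∈S} e^{−b|x−u|_∞} ≤ K_d(b) := (2/(1−e^{−b/(d+1)}))^{d+1}` for every finite
    `S ⊂ ℤ^{d+1}` (`sum_exp_supNorm_le`, via `|·|_∞ ≥ |·|₁/(d+1)` and a product of one-dimensional geometric sums), and the far
    version `Σ_{x∈S, |x−u|≥r} ≤ e^{−br/2}K_d(b/2)` (`sum_exp_supNorm_far_le`); `Ksum`, `K2` are the constants.
 §2 `G5 i δ x = Σ_{u∈Λ₅}e^{−δ|x−u|}`, `weight` (the `x`-dependent profile: `G5` off `Λ₄`, indicators of the `Λ₄`-rows/columns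
    against `Λ₃ᶜ`, `e^{−δr}` on `Λ₃×Λ₃`), **`abs_hk_le_weight`**: `|h_k(p,q)| ≤ c₀e^{2δ₀}e^{−δ₀|x−x′|}·weight(x,x′)` from
    (2.27)/(2.29) for `Ω, Ω₁, Ω₂` (hypotheses `h27/h29a/h29b`, discharged in §4 by `prop22Small_regularPairW`) and the
    separations (2.8) recorded in `Adm` (`sep45/sep34/sep2k`).
 §3 `sum_T1_le … sum_T4_le` (private) and **`sum_weight_le`**: `Σ_{x,x′∈Λ₆′}e^{−δ₀|x−x′|}weight(x,x′) ≤ K₂(δ₀)e^{−δ₀r/2}|Λ₃^{(k)}|`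
    (`|Λ₅|, |Λ₄| ≤ |Λ₃|` by `Λ₅ ⊂ Λ₄ ⊂ Λ₃`).
 §4 **`abs_form_hk_le`**: for `N ≥ 1`, every orthogonal flow with a Lipschitz bound, window `0 < a₋ ≤ a₊`, `c ≥ 0`, `β > 0`, `M`,
    there are `e₁ > 0, C ≥ 0, δ₁ > 0` (`δ₁ = δ₀/2`, `C = c₀e^{2δ₀}N²K₂`) with `|⟨φ, H_kφ⟩| ≤ C·t²·e^{−δ₁r}·|Λ₃^{(k)}|` for EVERY
    admissible step and every `φ` on `Λ₆′×{1..N}` with `|φ| ≤ t`; **`abs_form_hk_le_pow`**: with `r = r(Lᵏε)` (`B2.rFn`) in the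
    printed ranges (`B2.Params.Printed`), `0 < Lᵏε ≤ 1` and a threshold `0 ≤ t ≤ T(Lᵏε)^{−m}`, for every `κ` a `C′` with
    `|⟨φ, H_kφ⟩| ≤ C′(Lᵏε)^κ|Λ₃^{(k)}|` — the printed "O((Lᵏε)^κ)|Λ₃^{(k)}|".
 §5 (v1.1) `pFn_le_rpow` (`p(x) ≤ b₀x^{−p}` on `(0,1]`), `printedThreshold_le` (the threshold in its `d = 3` normal form
    `cl·(L^{k−1}ε)^{−1/4}p(L^{k−1}ε)` is `≤ (cl·b₀L^{1/4+p})(Lᵏε)^{−(1/4+p)}`), **`abs_form_hk_le_printed`**: the error term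
    `≤ C′(Lᵏε)^κ|Λ₃^{(k)}|` for every `κ` under `|φ| ≤ cl·(L^{k−1}ε)^{−1/4}p(L^{k−1}ε)` and the printed ranges (`d = 3` form).
 §6 (v1.3) the PRINTED threshold for every `d`: `printedThreshold_rpow_le` (`c(ℓ/L)^{−q}p(ℓ/L) ≤ (cb₀L^{q+p})ℓ^{−(q+p)}`, any
    real `q`), `thrPhi_pFn_eq` (`c₁p(x)/λ(x)^{1/4} = c₁λ^{−1/4}x^{−(4−d)/4}p(x)`, typer's `B2LargeField.thrPhi`/`lambdaEps`),
    `thrPhi_pFn_nonneg`, `printedThreshold_thrPhi_le`, **`abs_form_hk_le_printed'`**: the error term `≤ C′(Lᵏε)^κ|Λ₃^{(k)}|` for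
    every `κ` directly under (2.55)₄ `|φ| ≤ (c₁/λ(L^{k−1}ε)^{1/4})p(L^{k−1}ε)`, `λ(ε) = λε^{4−d}`, `d = P.d`, and the printed ranges.

HONEST SCOPE.  (a) As in the companions, `H_k` is the lineage's concrete operator at a REGULAR background field (p17's
`B1Prop22RegularFieldAlg.deltaK`; Proposition I.2.2 enters through `prop22Small_regularPairW`, i.e. for fields in the window
(1.8)–(1.9) with the big-block geometry `Adm.blkΩ/blk1/blk2`), not Bałaban's operator at a general `B̃`; the identification of the
third term's field `B^{(k+1),η}` with `B̃` on `Ω₂` is the domain statement recorded in `B2Ineq2109RegularField`.  (b) The field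
restriction is a pointwise threshold: §4 takes `|φ| ≤ t ≤ T(Lᵏε)^{−m}`; §6 (v1.3) the printed (2.55)₄ threshold
`(c₁/λ(L^{k−1}ε)^{1/4})p(L^{k−1}ε)` itself, `λ(·)` the FUNCTION `λ(ε) = λε^{4−d}` of p. 557 (typer's `B2LargeField.thrPhi`,
`lambdaEps`), majorized by `T(Lᵏε)^{−m}` with `T = c₁λ^{−1/4}b₀L^{(4−d)/4+p}`, `m = (4−d)/4 + p` (`d = P.d`; exponent `1/4` at
`d = 3`, `1/2` at `d = 2`); §5 (v1.1) is the `d = 3` normal form `cl·(L^{k−1}ε)^{−1/4}p(L^{k−1}ε)` (`cl = c₁λ^{−1/4}`) — the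
v1.1/v1.2 sentence «the product `c₁λ` is one nonnegative parameter `cl`» read `λ(·)` as a constant and is WITHDRAWN
(second-reader note S-B2-r14g16-1); the `ψ`-restriction plays no role for the `H_k` term.
(c) The separations `r ≤ dist` used are hypotheses of `Adm` (fields `sep45/sep34/sep2k`), i.e. (2.8) is ASSUMED for the step, not
derived from the construction (2.7) of the sets.  (d) Constants are explicit but not optimized (`K₂`, halving of `δ₀`).  (e) Value
= kernel certificate that the printed error term of (2.108) follows from (2.27)/(2.29) + (2.8) for the concrete operators; NOT
summit progress.
-/

namespace Literature.MathematicalPhysics.QuantumFieldTheory.Balaban1983to89.B2Eq2108ErrorBound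

open Finset Matrix
open Literature.MathematicalPhysics.QuantumFieldTheory.Balaban1983to89
open Literature.MathematicalPhysics.QuantumFieldTheory.Balaban1983to89.B4GaugeCovariance (OrthFlow)
open Literature.MathematicalPhysics.QuantumFieldTheory.Balaban1983to89.B4Lower18 (fineDom IsBlockUnion)
open Literature.MathematicalPhysics.QuantumFieldTheory.Balaban1983to89.B4ContourShift (supNorm supNorm_nonneg
  abs_le_supNorm exists_supNorm_eq)
open Literature.MathematicalPhysics.QuantumFieldTheory.Balaban1983to89.B4Reflection242 (supNorm_le_of_forall)
open Literature.MathematicalPhysics.QuantumFieldTheory.Balaban1983to89.B4TwoRegion120 (incl)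
open Literature.MathematicalPhysics.QuantumFieldTheory.Balaban1983to89.B4Cor23RegularWindow (RegularPairInstanceW
  prop22Small_regularPairW)
open Literature.MathematicalPhysics.QuantumFieldTheory.Balaban1983to89.B1Prop22RegularField (regDict)
open Literature.MathematicalPhysics.QuantumFieldTheory.Balaban1983to89.B2Ineq2109RegularField (Inst Adm AdmInst
  abs_deltaK_entry_le abs_deltaK_entry_sub_le le_distOc)

noncomputable section

variable {d : ℕ}

/-! ## §1 Lattice sums: `Σ_{x ∈ S ⊂ ℤ^{d+1}} e^{−b|x − u|_∞} ≤ K_d(b)` uniformly in the finite set `S` and the centre `u` -/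

section LatticeSum

/-- one-dimensional geometric bound: `Σ_{y ∈ T} e^{−b|y − c|} ≤ 2/(1 − e^{−b})` for every finite `T ⊂ ℤ`. [folklore] -/
private theorem sum_exp_abs_sub_le {b : ℝ} (hb : 0 < b) (c : ℤ) (T : Finset ℤ) :
    ∑ y ∈ T, Real.exp (-(b * |((y - c : ℤ) : ℝ)|)) ≤ 2 / (1 - Real.exp (-b)) := by
  set q : ℝ := Real.exp (-b) with hq
  have hq0 : 0 ≤ q := (Real.exp_pos _).le
  have hq1 : q < 1 := Real.exp_lt_one_iff.2 (by linarith)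
  have hterm : ∀ y : ℤ, Real.exp (-(b * |((y - c : ℤ) : ℝ)|)) = q ^ (y - c).natAbs := by
    intro y
    rw [hq, ← Real.exp_nat_mul, Nat.cast_natAbs, Int.cast_abs]
    ring_nf
  simp_rw [hterm]
  have hgeom : ∀ A : Finset ℕ, ∑ n ∈ A, q ^ n ≤ (1 - q)⁻¹ := fun A => by
    rw [← tsum_geometric_of_lt_one hq0 hq1]
    exact (summable_geometric_of_lt_one hq0 hq1).sum_le_tsum A (fun n _ => pow_nonneg hq0 n)
  -- split `T` at `c`
  rw [← Finset.sum_filter_add_sum_filter_not T (fun y => c ≤ y)]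
  have h1 : ∑ y ∈ T with c ≤ y, q ^ (y - c).natAbs ≤ (1 - q)⁻¹ := by
    have hinj : Set.InjOn (fun y : ℤ => (y - c).natAbs) ↑(T.filter fun y => c ≤ y) := by
      intro y hy y' hy' h
      simp only [Finset.coe_filter, Set.mem_setOf_eq] at hy hy'
      have e1 : ((y - c).natAbs : ℤ) = y - c := Int.natAbs_of_nonneg (by linarith [hy.2])
      have e2 : ((y' - c).natAbs : ℤ) = y' - c := Int.natAbs_of_nonneg (by linarith [hy'.2])
      have : ((y - c).natAbs : ℤ) = (y' - c).natAbs := by exact_mod_cast h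
      linarith
    rw [← Finset.sum_image hinj]
    exact hgeom _
  have h2 : ∑ y ∈ T with ¬c ≤ y, q ^ (y - c).natAbs ≤ (1 - q)⁻¹ := by
    have hinj : Set.InjOn (fun y : ℤ => (y - c).natAbs) ↑(T.filter fun y => ¬c ≤ y) := by
      intro y hy y' hy' h
      simp only [Finset.coe_filter, Set.mem_setOf_eq, not_le] at hy hy'
      have e1 : ((y - c).natAbs : ℤ) = -(y - c) := Int.ofNat_natAbs_of_nonpos (by linarith [hy.2])
      have e2 : ((y' - c).natAbs : ℤ) = -(y' - c) := Int.ofNat_natAbs_of_nonpos (by linarith [hy'.2])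
      have : ((y - c).natAbs : ℤ) = (y' - c).natAbs := by exact_mod_cast h
      linarith
    rw [← Finset.sum_image hinj]
    exact hgeom _
  have hq1' : 0 < 1 - q := by linarith
  calc _ ≤ (1 - q)⁻¹ + (1 - q)⁻¹ := add_le_add h1 h2
    _ = 2 / (1 - q) := by rw [div_eq_mul_inv]; ring

/-- `Σ_i |z_i| ≤ (d+1)|z|_∞`. [folklore] -/
private theorem sum_abs_le_card_mul_supNorm (z : Fin (d + 1) → ℤ) :
    ∑ i, |((z i : ℤ) : ℝ)| ≤ ((d : ℝ) + 1) * supNorm z := by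
  have h : ∀ i, |((z i : ℤ) : ℝ)| ≤ supNorm z := fun i => by
    have := abs_le_supNorm z i; rwa [Int.cast_abs] at this
  calc ∑ i, |((z i : ℤ) : ℝ)| ≤ ∑ _i : Fin (d + 1), supNorm z := Finset.sum_le_sum fun i _ => h i
    _ = ((d : ℝ) + 1) * supNorm z := by simp [Finset.sum_const, Finset.card_univ, Fintype.card_fin]

/-- the constant `K_d(b) = (2/(1 − e^{−b/(d+1)}))^{d+1}`. [folklore] -/
def Ksum (d : ℕ) (b : ℝ) : ℝ := (2 / (1 - Real.exp (-(b / ((d : ℝ) + 1))))) ^ (d + 1)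

/-- `K_d(b) ≥ 0` for `b > 0`. [folklore] -/
private theorem Ksum_nonneg {b : ℝ} (hb : 0 < b) : 0 ≤ Ksum d b := by
  unfold Ksum
  have : Real.exp (-(b / ((d : ℝ) + 1))) < 1 := Real.exp_lt_one_iff.2 (by
    have : (0 : ℝ) < (d : ℝ) + 1 := by positivity
    exact neg_neg_of_pos (div_pos hb this))
  positivity

/-- **the lattice sum**: `Σ_{x ∈ S} e^{−b|x − u|_∞} ≤ K_d(b)` for every finite `S ⊂ ℤ^{d+1}` and every `u`. [folklore] -/
private theorem sum_exp_supNorm_le {b : ℝ} (hb : 0 < b) (u : Fin (d + 1) → ℤ) (S : Finset (Fin (d + 1) → ℤ)) :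
    ∑ x ∈ S, Real.exp (-(b * supNorm (x - u))) ≤ Ksum d b := by
  classical
  set b' : ℝ := b / ((d : ℝ) + 1) with hb'
  have hd : (0 : ℝ) < (d : ℝ) + 1 := by positivity
  have hb'0 : 0 < b' := div_pos hb hd
  -- pointwise: sup norm ≥ average of the coordinates
  have hpt : ∀ x : Fin (d + 1) → ℤ,
      Real.exp (-(b * supNorm (x - u))) ≤ ∏ i, Real.exp (-(b' * |((x i - u i : ℤ) : ℝ)|)) := by
    intro x
    rw [← Real.exp_sum, Real.exp_le_exp]
    have hs := sum_abs_le_card_mul_supNorm (x - u)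
    have : ∑ i, -(b' * |((x i - u i : ℤ) : ℝ)|) = -(b' * ∑ i, |(((x - u) i : ℤ) : ℝ)|) := by
      rw [Finset.mul_sum, ← Finset.sum_neg_distrib]
      simp [Pi.sub_apply]
    rw [this, neg_le_neg_iff]
    calc b' * ∑ i, |(((x - u) i : ℤ) : ℝ)| ≤ b' * (((d : ℝ) + 1) * supNorm (x - u)) :=
          mul_le_mul_of_nonneg_left hs hb'0.le
      _ = b * supNorm (x - u) := by rw [hb']; field_simp
  -- embed `S` in the product of its coordinate projections
  set t : Fin (d + 1) → Finset ℤ := fun i => S.image fun x => x i with ht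
  have hsub : S ⊆ Fintype.piFinset t := fun x hx => Fintype.mem_piFinset.2 fun i => Finset.mem_image_of_mem _ hx
  calc ∑ x ∈ S, Real.exp (-(b * supNorm (x - u)))
      ≤ ∑ x ∈ S, ∏ i, Real.exp (-(b' * |((x i - u i : ℤ) : ℝ)|)) := Finset.sum_le_sum fun x _ => hpt x
    _ ≤ ∑ x ∈ Fintype.piFinset t, ∏ i, Real.exp (-(b' * |((x i - u i : ℤ) : ℝ)|)) :=
        Finset.sum_le_sum_of_subset_of_nonneg hsub fun x _ _ => Finset.prod_nonneg fun i _ => (Real.exp_pos _).le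
    _ = ∏ i, ∑ y ∈ t i, Real.exp (-(b' * |((y - u i : ℤ) : ℝ)|)) :=
        (Finset.prod_univ_sum t fun i y => Real.exp (-(b' * |((y - u i : ℤ) : ℝ)|))).symm
    _ ≤ ∏ _i : Fin (d + 1), 2 / (1 - Real.exp (-b')) :=
        Finset.prod_le_prod (fun i _ => Finset.sum_nonneg fun y _ => (Real.exp_pos _).le)
          fun i _ => sum_exp_abs_sub_le hb'0 (u i) (t i)
    _ = Ksum d b := by rw [Finset.prod_const, Finset.card_univ, Fintype.card_fin]; rfl

/-- the lattice sum with a separation: `Σ_{x ∈ S, |x−u| ≥ r} e^{−b|x−u|} ≤ e^{−(b/2)r}K_d(b/2)`. [folklore] -/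
private theorem sum_exp_supNorm_far_le {b r : ℝ} (hb : 0 < b) (u : Fin (d + 1) → ℤ) (S : Finset (Fin (d + 1) → ℤ))
    (hfar : ∀ x ∈ S, r ≤ supNorm (x - u)) :
    ∑ x ∈ S, Real.exp (-(b * supNorm (x - u))) ≤ Real.exp (-(b / 2 * r)) * Ksum d (b / 2) := by
  have h := sum_exp_supNorm_le (half_pos hb) u S
  have hpt : ∀ x ∈ S, Real.exp (-(b * supNorm (x - u)))
      ≤ Real.exp (-(b / 2 * r)) * Real.exp (-(b / 2 * supNorm (x - u))) := by
    intro x hx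
    rw [← Real.exp_add, Real.exp_le_exp]
    nlinarith [hfar x hx, hb]
  calc ∑ x ∈ S, Real.exp (-(b * supNorm (x - u)))
      ≤ ∑ x ∈ S, Real.exp (-(b / 2 * r)) * Real.exp (-(b / 2 * supNorm (x - u))) := Finset.sum_le_sum hpt
    _ = Real.exp (-(b / 2 * r)) * ∑ x ∈ S, Real.exp (-(b / 2 * supNorm (x - u))) := by rw [Finset.mul_sum]
    _ ≤ Real.exp (-(b / 2 * r)) * Ksum d (b / 2) := mul_le_mul_of_nonneg_left h (Real.exp_pos _).le

end LatticeSum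

/-! ## §2 The `x`-dependent damping of the kernel of `H_k`

The (2.109) bound `C e^{−δ₁r} e^{−δ₀|x−x′|}` is uniform in `x`; summed over `Λ₆^{(k−1)′} × Λ₆^{(k−1)′}` it would give the
volume `|Λ₆^{(k−1)′}|`.  The printed volume `|Λ₃^{(k)}|` comes from keeping, in the `δΔ(Ω₁,Ω)` blocks, the damping in the
distance of `x` to `Λ₅^{(k)}` (the weight `G₅(x) = Σ_{u∈Λ₅} e^{−δ₀|x−u|}`), and in the far blocks the indicator of `Λ₄^{(k)}`.
[cite: Balaban1982Higgs2, (2.108) p.580] -/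

section Weights

variable {ι : Type} [Fintype ι] [DecidableEq ι] {aminus aplus : ℝ}

/-- two regions with the same unit labels carry the same operator (void localizations). [folklore] -/
private theorem deltaK_entry_of_eq (F : OrthFlow ι) (e : ℝ) {n : ℕ} (hn : 1 ≤ n) (a m2 : ℝ)
    (Ac : (Fin (d + 1) → ℤ) → Fin (d + 1) → ℝ) (S T : Finset (Fin (d + 1) → ℤ)) (hST : S = T) (h : S ⊆ T)
    (y y' : ↥S) (l l' : ι) :
    B1Prop22RegularFieldAlg.deltaK F e hn a m2 S Ac (y, l) (y', l')
      = B1Prop22RegularFieldAlg.deltaK F e hn a m2 T Ac (incl h y, l) (incl h y', l') := by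
  subst hST
  have h1 : incl h y = y := Subtype.ext rfl
  have h2 : incl h y' = y' := Subtype.ext rfl
  rw [h1, h2]

/-- the weight `G₅(x) = Σ_{u ∈ Λ₅^{(k)}} e^{−δ|x − u|}` (`= 0` when `Λ₅^{(k)} = ∅`). [cite: Balaban1982Higgs2, (2.108) p.580] -/
def G5 (i : Inst d aminus aplus) (δ : ℝ) (x : Fin (d + 1) → ℤ) : ℝ := ∑ u ∈ i.L5, Real.exp (-(δ * supNorm (x - u)))

/-- `G₅ ≥ 0`. [folklore] -/
private theorem G5_nonneg (i : Inst d aminus aplus) (δ : ℝ) (x : Fin (d + 1) → ℤ) : 0 ≤ G5 i δ x :=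
  Finset.sum_nonneg fun _ _ => (Real.exp_pos _).le

/-- the `δΔ` damping in the distance to `Λ₅`: if `dist(y,Ω₁^{(k)c}) ≥ d₅(x) − 1` is fed by the minimal label distance
`d₅(x) = min_{u∈Λ₅}|x − u|`, then `e^{−δ₀ d₅(x)} ≤ G₅(x)`. [folklore] -/
private theorem exp_inf_le_G5 (i : Inst d aminus aplus) {δ : ℝ} (x : Fin (d + 1) → ℤ) (h5 : i.L5.Nonempty) :
    Real.exp (-(δ * i.L5.inf' h5 (fun u => supNorm (x - u)))) ≤ G5 i δ x := by
  obtain ⟨u₀, hu₀, heq⟩ := Finset.exists_mem_eq_inf' h5 (fun u => supNorm (x - u))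
  rw [heq]
  exact Finset.single_le_sum (f := fun u => Real.exp (-(δ * supNorm (x - u)))) (fun _ _ => (Real.exp_pos _).le) hu₀

/-- the weight of the refined bound: `w(x,x′) = [x∉Λ₄]G₅(x) + [x∉Λ₃][x′∈Λ₄] + [x∈Λ₄][x′∉Λ₃] + [x,x′∈Λ₃]e^{−δ₀r}`.
[cite: Balaban1982Higgs2, (2.108) p.580] -/
def weight (i : Inst d aminus aplus) (δ : ℝ) (x x' : Fin (d + 1) → ℤ) : ℝ :=
  (if x ∉ i.L4 then G5 i δ x else 0) + (if x ∉ i.L3 ∧ x' ∈ i.L4 then 1 else 0)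
    + (if x ∈ i.L4 ∧ x' ∉ i.L3 then 1 else 0) + (if x ∈ i.L3 ∧ x' ∈ i.L3 then Real.exp (-(δ * i.r)) else 0)

/-- all four summands of the weight are `≥ 0`. [folklore] -/
private theorem weight_parts_nonneg (i : Inst d aminus aplus) (δ : ℝ) (x x' : Fin (d + 1) → ℤ) :
    0 ≤ (if x ∉ i.L4 then G5 i δ x else 0) ∧ 0 ≤ (if x ∉ i.L3 ∧ x' ∈ i.L4 then (1 : ℝ) else 0) ∧
    0 ≤ (if x ∈ i.L4 ∧ x' ∉ i.L3 then (1 : ℝ) else 0) ∧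
    0 ≤ (if x ∈ i.L3 ∧ x' ∈ i.L3 then Real.exp (-(δ * i.r)) else 0) := by
  refine ⟨?_, ?_, ?_, ?_⟩ <;> split_ifs <;> first | exact G5_nonneg _ _ _ | positivity

/-- **THE REFINED KERNEL BOUND** `|h_k(x,x′)| ≤ c₀e^{2δ₀}·e^{−δ₀|x−x′|}·w(x,x′)`, given (I.2.27) on `Ω` and (I.2.29) on the pairs
`Ω₁ ⊆ Ω`, `Ω₂ ⊆ Ω` with constants `(δ₀, c₀)` (matrix-element form) and the standing context `Adm`.
[cite: Balaban1982Higgs2, (2.108)–(2.109) p.580] -/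
theorem abs_hk_le_weight (F : OrthFlow ι) {c β e₁ δ₀ c₀ : ℝ} {M : ℕ} (i : Inst d aminus aplus) (hA : Adm c β M e₁ i)
    (hδ₀ : 0 < δ₀) (hc₀ : 0 ≤ c₀)
    (h27 : ∀ (y y' : ↥i.Ωc) (l l' : ι),
      |B1Prop22RegularFieldAlg.deltaK F i.e i.hn i.ak i.m2 i.Ωc i.Ac (y, l) (y', l')|
        ≤ c₀ * Real.exp (-(δ₀ * supNorm (y.1 - y'.1))))
    (h29a : ∀ (y y' : ↥(i.Ωc \ i.L5)) (l l' : ι),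
      |B1Prop22RegularFieldAlg.deltaK F i.e i.hn i.ak i.m2 (i.Ωc \ i.L5) i.Ac (y, l) (y', l')
          - B1Prop22RegularFieldAlg.deltaK F i.e i.hn i.ak i.m2 i.Ωc i.Ac
              (incl Finset.sdiff_subset y, l) (incl Finset.sdiff_subset y', l')|
        ≤ c₀ * Real.exp (-(δ₀ * (supNorm (y.1 - y'.1)
            + B1Prop22RegularField.Inst.distOc i.pair1.toRegularPairInstance y
            + B1Prop22RegularField.Inst.distOc i.pair1.toRegularPairInstance y'))))
    (h29b : ∀ (y y' : ↥i.L2k) (l l' : ι),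
      |B1Prop22RegularFieldAlg.deltaK F i.e i.hn i.ak i.m2 i.L2k i.Ac (y, l) (y', l')
          - B1Prop22RegularFieldAlg.deltaK F i.e i.hn i.ak i.m2 i.Ωc i.Ac (incl i.h2k y, l) (incl i.h2k y', l')|
        ≤ c₀ * Real.exp (-(δ₀ * (supNorm (y.1 - y'.1)
            + B1Prop22RegularField.Inst.distOc i.pair2.toRegularPairInstance y
            + B1Prop22RegularField.Inst.distOc i.pair2.toRegularPairInstance y'))))
    (p q : ↥i.L6 × ι) :
    |i.hk F p q| ≤ c₀ * Real.exp (2 * δ₀) * Real.exp (-(δ₀ * supNorm (p.1.1 - q.1.1))) * weight i δ₀ p.1.1 q.1.1 := by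
  set D := supNorm (p.1.1 - q.1.1) with hD
  have hD0 : 0 ≤ D := supNorm_nonneg _
  set C₁ := c₀ * Real.exp (2 * δ₀) * Real.exp (-(δ₀ * D)) with hC₁
  have hC₁0 : 0 ≤ C₁ := by positivity
  obtain ⟨w1, w2, w3, w4⟩ := weight_parts_nonneg i δ₀ p.1.1 q.1.1
  have hr := hA.hr
  -- the four target shapes
  have tgt1 : ∀ {v : ℝ}, p.1.1 ∉ i.L4 → v ≤ C₁ * G5 i δ₀ p.1.1 → v ≤ C₁ * weight i δ₀ p.1.1 q.1.1 := by
    intro v hp4 hv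
    refine hv.trans ?_
    unfold weight; rw [if_pos hp4]; nlinarith [G5_nonneg i δ₀ p.1.1]
  have tgt2 : ∀ {v : ℝ}, p.1.1 ∉ i.L3 → q.1.1 ∈ i.L4 → v ≤ C₁ → v ≤ C₁ * weight i δ₀ p.1.1 q.1.1 := by
    intro v hp3 hq4 hv
    refine hv.trans ?_
    unfold weight; rw [if_pos (show p.1.1 ∉ i.L3 ∧ q.1.1 ∈ i.L4 from ⟨hp3, hq4⟩)]; nlinarith
  have tgt3 : ∀ {v : ℝ}, p.1.1 ∈ i.L4 → q.1.1 ∉ i.L3 → v ≤ C₁ → v ≤ C₁ * weight i δ₀ p.1.1 q.1.1 := by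
    intro v hp4 hq3 hv
    refine hv.trans ?_
    unfold weight; rw [if_pos (show p.1.1 ∈ i.L4 ∧ q.1.1 ∉ i.L3 from ⟨hp4, hq3⟩)]; nlinarith
  have tgt4 : ∀ {v : ℝ}, p.1.1 ∈ i.L3 → q.1.1 ∈ i.L3 → v ≤ C₁ * Real.exp (-(δ₀ * i.r)) →
      v ≤ C₁ * weight i δ₀ p.1.1 q.1.1 := by
    intro v hp3 hq3 hv
    refine hv.trans ?_
    unfold weight; rw [if_pos (show p.1.1 ∈ i.L3 ∧ q.1.1 ∈ i.L3 from ⟨hp3, hq3⟩)]; nlinarith [Real.exp_pos (-(δ₀ * i.r))]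
  -- the `δΔ(Ω₁ ⊆ Ω)` blocks with the `x`-dependent damping
  have caseΩ1 : p.1.1 ∉ i.L4 → q.1.1 ∉ i.L4 → i.hk F p q = i.DΩ F p q - i.D1 F p q →
      |i.hk F p q| ≤ C₁ * weight i δ₀ p.1.1 q.1.1 := by
    intro hp4 hq4 hform
    have hp5 : p.1.1 ∉ i.L5 := fun h => hp4 (i.h54 h)
    have hq5 : q.1.1 ∉ i.L5 := fun h => hq4 (i.h54 h)
    refine tgt1 hp4 ?_
    rw [hform, B2Ineq2109RegularField.Inst.DΩ_sub_D1 hp5 hq5, abs_neg]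
    by_cases h5 : i.L5.Nonempty
    · have hne : ∃ u ∈ i.Ωc, u ∉ i.Ωc \ i.L5 := by
        obtain ⟨u, hu⟩ := h5
        exact ⟨u, i.h6 (i.h36 (i.h43 (i.h54 hu))), fun h => (Finset.mem_sdiff.1 h).2 hu⟩
      have hmem5 : ∀ u ∈ i.Ωc, u ∉ i.Ωc \ i.L5 → u ∈ i.L5 := fun u hu hu' => by
        by_contra h; exact hu' (Finset.mem_sdiff.2 ⟨hu, h⟩)
      set d5 := i.L5.inf' h5 (fun u => supNorm (p.1.1 - u)) with hd5
      have hdp := le_distOc (R := d5) i.pair1.toRegularPairInstance ⟨p.1.1, i.mem_sdiff_of p.1 hp5⟩ hne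
        (fun u hu hu' => by
          show d5 ≤ supNorm (p.1.1 - u)
          exact Finset.inf'_le (fun u => supNorm (p.1.1 - u)) (hmem5 u hu hu'))
      have hdq := le_distOc i.pair1.toRegularPairInstance ⟨q.1.1, i.mem_sdiff_of q.1 hq5⟩ hne
        (fun u hu hu' => hA.sep45 q.1.1 q.1.2 hq4 u (hmem5 u hu hu'))
      have hG := exp_inf_le_G5 i (δ := δ₀) p.1.1 h5
      refine (h29a _ _ p.2 q.2).trans ?_
      have hexp : Real.exp (-(δ₀ * (D + B1Prop22RegularField.Inst.distOc i.pair1.toRegularPairInstance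
            ⟨p.1.1, i.mem_sdiff_of p.1 hp5⟩ + B1Prop22RegularField.Inst.distOc i.pair1.toRegularPairInstance
            ⟨q.1.1, i.mem_sdiff_of q.1 hq5⟩)))
          ≤ Real.exp (2 * δ₀) * Real.exp (-(δ₀ * D)) * Real.exp (-(δ₀ * d5)) := by
        rw [← Real.exp_add, ← Real.exp_add, Real.exp_le_exp]
        nlinarith [mul_le_mul_of_nonneg_left hdp hδ₀.le, mul_le_mul_of_nonneg_left hdq hδ₀.le,
          mul_nonneg hδ₀.le hr]
      calc c₀ * Real.exp (-(δ₀ * (D + _ + _))) ≤ c₀ * (Real.exp (2 * δ₀) * Real.exp (-(δ₀ * D)) * Real.exp (-(δ₀ * d5))) :=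
            mul_le_mul_of_nonneg_left hexp hc₀
        _ = C₁ * Real.exp (-(δ₀ * d5)) := by rw [hC₁]; ring
        _ ≤ C₁ * G5 i δ₀ p.1.1 := mul_le_mul_of_nonneg_left hG hC₁0
    · -- `Λ₅ = ∅`: the block vanishes
      have hEq : i.Ωc \ i.L5 = i.Ωc := by
        rw [Finset.not_nonempty_iff_eq_empty.1 h5, Finset.sdiff_empty]
      rw [deltaK_entry_of_eq F i.e i.hn i.ak i.m2 i.Ac _ _ hEq Finset.sdiff_subset, sub_self, abs_zero]
      exact mul_nonneg hC₁0 (G5_nonneg _ _ _)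
  -- the `Δ(Ω)` blocks (no `r` needed pointwise; the separation is used when summing)
  have caseFar : i.hk F p q = i.DΩ F p q → |i.hk F p q| ≤ C₁ := by
    intro hform
    rw [hform, B2Ineq2109RegularField.Inst.DΩ_eq]
    refine (h27 _ _ p.2 q.2).trans ?_
    rw [hC₁]
    have : Real.exp (-(δ₀ * D)) ≤ Real.exp (2 * δ₀) * Real.exp (-(δ₀ * D)) := by
      have h1 : (1 : ℝ) ≤ Real.exp (2 * δ₀) := Real.one_le_exp (by positivity)
      nlinarith [Real.exp_pos (-(δ₀ * D))]
    calc c₀ * Real.exp (-(δ₀ * supNorm ((incl i.h6 p.1).1 - (incl i.h6 q.1).1)))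
        = c₀ * Real.exp (-(δ₀ * D)) := rfl
      _ ≤ c₀ * (Real.exp (2 * δ₀) * Real.exp (-(δ₀ * D))) := mul_le_mul_of_nonneg_left this hc₀
      _ = c₀ * Real.exp (2 * δ₀) * Real.exp (-(δ₀ * D)) := by ring
  by_cases hp3 : p.1.1 ∈ i.L3 <;> by_cases hq3 : q.1.1 ∈ i.L3
  · -- `Λ₃ × Λ₃`
    refine tgt4 hp3 hq3 ?_
    rw [B2Ineq2109RegularField.Inst.hk_33 hp3 hq3, B2Ineq2109RegularField.Inst.DΩ_sub_D2 hp3 hq3, abs_neg]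
    by_cases hne : ∃ u ∈ i.Ωc, u ∉ i.L2k
    · have hdp := le_distOc i.pair2.toRegularPairInstance ⟨p.1.1, i.h32 hp3⟩ hne
        (fun u hu hu' => hA.sep2k p.1.1 hp3 u hu hu')
      have hdq := le_distOc i.pair2.toRegularPairInstance ⟨q.1.1, i.h32 hq3⟩ hne
        (fun u hu hu' => hA.sep2k q.1.1 hq3 u hu hu')
      refine (h29b _ _ p.2 q.2).trans ?_
      have hexp : Real.exp (-(δ₀ * (D + B1Prop22RegularField.Inst.distOc i.pair2.toRegularPairInstance
            ⟨p.1.1, i.h32 hp3⟩ + B1Prop22RegularField.Inst.distOc i.pair2.toRegularPairInstance ⟨q.1.1, i.h32 hq3⟩)))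
          ≤ Real.exp (2 * δ₀) * Real.exp (-(δ₀ * D)) * Real.exp (-(δ₀ * i.r)) := by
        rw [← Real.exp_add, ← Real.exp_add, Real.exp_le_exp]
        nlinarith [mul_le_mul_of_nonneg_left hdp hδ₀.le, mul_le_mul_of_nonneg_left hdq hδ₀.le,
          mul_nonneg hδ₀.le hr]
      calc c₀ * Real.exp (-(δ₀ * (D + _ + _))) ≤ c₀ * (Real.exp (2 * δ₀) * Real.exp (-(δ₀ * D)) * Real.exp (-(δ₀ * i.r))) :=
            mul_le_mul_of_nonneg_left hexp hc₀
        _ = C₁ * Real.exp (-(δ₀ * i.r)) := by rw [hC₁]; ring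
    · push Not at hne
      have hEq : i.L2k = i.Ωc := Finset.Subset.antisymm i.h2k fun u hu => hne u hu
      rw [deltaK_entry_of_eq F i.e i.hn i.ak i.m2 i.Ac _ _ hEq i.h2k, sub_self, abs_zero]
      positivity
  · -- `Λ₃ × P`
    by_cases hp4 : p.1.1 ∈ i.L4
    · exact tgt3 hp4 hq3 (caseFar (B2Ineq2109RegularField.Inst.hk_4P hp4 hq3))
    · exact caseΩ1 hp4 (fun h => hq3 (i.h43 h)) (B2Ineq2109RegularField.Inst.hk_34P hp3 hp4 hq3)
  · -- `P × Λ₃`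
    by_cases hq4 : q.1.1 ∈ i.L4
    · exact tgt2 hp3 hq4 (caseFar (B2Ineq2109RegularField.Inst.hk_P4 hp3 hq4))
    · exact caseΩ1 (fun h => hp3 (i.h43 h)) hq4 (B2Ineq2109RegularField.Inst.hk_P34 hp3 hq3 hq4)
  · -- `P × P`
    exact caseΩ1 (fun h => hp3 (i.h43 h)) (fun h => hq3 (i.h43 h)) (B2Ineq2109RegularField.Inst.hk_PP hp3 hq3)

end Weights

/-! ## §3 Summing the refined bound: `Σ_{x,x′∈Λ₆′} e^{−δ₀|x−x′|}w(x,x′) ≤ K₂ e^{−δ₀r/2}|Λ₃^{(k)}|` -/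

section Sums

variable {ι : Type} [Fintype ι] [DecidableEq ι] {aminus aplus : ℝ}

/-- the sup norm is even. [folklore] -/
private theorem supNorm_neg (x : Fin (d + 1) → ℤ) : supNorm (-x) = supNorm x := by
  unfold B4ContourShift.supNorm
  congr 1
  funext i
  simp

/-- the sup distance is symmetric. [folklore] -/
private theorem supNorm_sub_comm (x y : Fin (d + 1) → ℤ) : supNorm (x - y) = supNorm (y - x) := by
  rw [← supNorm_neg, neg_sub]

/-- the summed constant `K₂ = K(δ₀)K(δ₀/2) + 2K(δ₀/2) + K(δ₀)`. [folklore] -/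
def K2 (d : ℕ) (δ₀ : ℝ) : ℝ := Ksum d δ₀ * Ksum d (δ₀ / 2) + 2 * Ksum d (δ₀ / 2) + Ksum d δ₀

/-- `K₂ ≥ 0`. [folklore] -/
private theorem K2_nonneg {δ₀ : ℝ} (hδ : 0 < δ₀) : 0 ≤ K2 d δ₀ := by
  have h1 := Ksum_nonneg (d := d) hδ
  have h2 := Ksum_nonneg (d := d) (half_pos hδ)
  unfold K2; positivity

/-- `T₁`: the `G₅` term, `Σ_{x∈Λ₆′∖Λ₄}G₅(x)·Σ_{x′}e^{−δ₀|x−x′|} ≤ K(δ₀)K(δ₀/2)e^{−δ₀r/2}|Λ₅|`. [cite: Balaban1982Higgs2, (2.108) p.580] -/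
private theorem sum_T1_le {c β e₁ δ₀ : ℝ} {M : ℕ} (i : Inst d aminus aplus) (hA : Adm c β M e₁ i) (hδ₀ : 0 < δ₀) :
    ∑ x ∈ i.L6, ∑ x' ∈ i.L6, Real.exp (-(δ₀ * supNorm (x - x'))) * (if x ∉ i.L4 then G5 i δ₀ x else 0)
      ≤ Ksum d δ₀ * Ksum d (δ₀ / 2) * Real.exp (-(δ₀ / 2 * i.r)) * (i.L5.card : ℝ) := by
  have hK := Ksum_nonneg (d := d) hδ₀
  have hK2 := Ksum_nonneg (d := d) (half_pos hδ₀)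
  -- inner sum ≤ K(δ₀)
  have hinner : ∀ x, ∑ x' ∈ i.L6, Real.exp (-(δ₀ * supNorm (x - x'))) ≤ Ksum d δ₀ := fun x => by
    have h := sum_exp_supNorm_le hδ₀ x i.L6
    refine le_trans (le_of_eq (Finset.sum_congr rfl fun x' _ => by rw [supNorm_sub_comm])) h
  have step1 : ∑ x ∈ i.L6, ∑ x' ∈ i.L6, Real.exp (-(δ₀ * supNorm (x - x'))) * (if x ∉ i.L4 then G5 i δ₀ x else 0)
      ≤ ∑ x ∈ i.L6, Ksum d δ₀ * (if x ∉ i.L4 then G5 i δ₀ x else 0) := by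
    refine Finset.sum_le_sum fun x _ => ?_
    rw [← Finset.sum_mul]
    refine mul_le_mul_of_nonneg_right (hinner x) ?_
    split_ifs <;> first | exact G5_nonneg _ _ _ | exact le_rfl
  refine step1.trans ?_
  rw [← Finset.mul_sum, Finset.sum_ite, Finset.sum_const_zero, add_zero]
  -- Σ_{x ∈ L6, x ∉ L4} G5 x = Σ_{u ∈ L5} Σ_{x ∈ L6 ∖ L4} e^{−δ₀|x−u|} ≤ |L5| e^{−δ₀r/2}K(δ₀/2)
  have hG : ∑ x ∈ i.L6 with x ∉ i.L4, G5 i δ₀ x ≤ (i.L5.card : ℝ) * (Real.exp (-(δ₀ / 2 * i.r)) * Ksum d (δ₀ / 2)) := by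
    unfold G5
    rw [Finset.sum_comm]
    have : ∀ u ∈ i.L5, ∑ x ∈ i.L6 with x ∉ i.L4, Real.exp (-(δ₀ * supNorm (x - u)))
        ≤ Real.exp (-(δ₀ / 2 * i.r)) * Ksum d (δ₀ / 2) := fun u hu =>
      sum_exp_supNorm_far_le hδ₀ u _ fun x hx => by
        rw [Finset.mem_filter] at hx
        exact hA.sep45 x hx.1 hx.2 u hu
    calc _ ≤ ∑ _u ∈ i.L5, Real.exp (-(δ₀ / 2 * i.r)) * Ksum d (δ₀ / 2) := Finset.sum_le_sum this
      _ = _ := by rw [Finset.sum_const, nsmul_eq_mul]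
  calc Ksum d δ₀ * ∑ x ∈ i.L6 with x ∉ i.L4, G5 i δ₀ x
      ≤ Ksum d δ₀ * ((i.L5.card : ℝ) * (Real.exp (-(δ₀ / 2 * i.r)) * Ksum d (δ₀ / 2))) :=
        mul_le_mul_of_nonneg_left hG hK
    _ = _ := by ring

/-- `T₂`: `Σ_{x∉Λ₃}Σ_{x′∈Λ₄}e^{−δ₀|x−x′|} ≤ K(δ₀/2)e^{−δ₀r/2}|Λ₄|` (separation (2.8) of `Λ₄` from `Λ₃ᶜ`). [cite: Balaban1982Higgs2, (2.108) p.580] -/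
private theorem sum_T2_le {c β e₁ δ₀ : ℝ} {M : ℕ} (i : Inst d aminus aplus) (hA : Adm c β M e₁ i) (hδ₀ : 0 < δ₀) :
    ∑ x ∈ i.L6, ∑ x' ∈ i.L6, Real.exp (-(δ₀ * supNorm (x - x'))) * (if x ∉ i.L3 ∧ x' ∈ i.L4 then (1 : ℝ) else 0)
      ≤ Ksum d (δ₀ / 2) * Real.exp (-(δ₀ / 2 * i.r)) * (i.L4.card : ℝ) := by
  rw [Finset.sum_comm]
  have hrow : ∀ x' ∈ i.L6, ∑ x ∈ i.L6, Real.exp (-(δ₀ * supNorm (x - x'))) * (if x ∉ i.L3 ∧ x' ∈ i.L4 then (1 : ℝ) else 0)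
      ≤ if x' ∈ i.L4 then Real.exp (-(δ₀ / 2 * i.r)) * Ksum d (δ₀ / 2) else 0 := by
    intro x' _
    by_cases hx' : x' ∈ i.L4
    · rw [if_pos hx']
      have : ∑ x ∈ i.L6, Real.exp (-(δ₀ * supNorm (x - x'))) * (if x ∉ i.L3 ∧ x' ∈ i.L4 then (1 : ℝ) else 0)
          = ∑ x ∈ i.L6 with x ∉ i.L3, Real.exp (-(δ₀ * supNorm (x - x'))) := by
        rw [Finset.sum_filter]
        refine Finset.sum_congr rfl fun x _ => ?_
        by_cases hx : x ∉ i.L3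
        · rw [if_pos ⟨hx, hx'⟩, if_pos hx, mul_one]
        · rw [if_neg (fun h => hx h.1), if_neg hx, mul_zero]
      rw [this]
      exact sum_exp_supNorm_far_le hδ₀ x' _ fun x hx => by
        rw [Finset.mem_filter] at hx
        exact hA.sep34 x hx.1 hx.2 x' hx'
    · rw [if_neg hx']
      refine le_of_eq (Finset.sum_eq_zero fun x _ => ?_)
      rw [if_neg (fun h => hx' h.2), mul_zero]
  refine (Finset.sum_le_sum hrow).trans ?_
  rw [Finset.sum_ite, Finset.sum_const_zero, add_zero, Finset.sum_const, nsmul_eq_mul]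
  have hcard : ((i.L6.filter fun x' => x' ∈ i.L4).card : ℝ) ≤ i.L4.card := by
    exact_mod_cast Finset.card_le_card fun x hx => (Finset.mem_filter.1 hx).2
  have hpos : 0 ≤ Real.exp (-(δ₀ / 2 * i.r)) * Ksum d (δ₀ / 2) := mul_nonneg (Real.exp_pos _).le (Ksum_nonneg (half_pos hδ₀))
  nlinarith

/-- `T₃`: `Σ_{x∈Λ₄}Σ_{x′∉Λ₃}e^{−δ₀|x−x′|} ≤ K(δ₀/2)e^{−δ₀r/2}|Λ₄|`. [cite: Balaban1982Higgs2, (2.108) p.580] -/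
private theorem sum_T3_le {c β e₁ δ₀ : ℝ} {M : ℕ} (i : Inst d aminus aplus) (hA : Adm c β M e₁ i) (hδ₀ : 0 < δ₀) :
    ∑ x ∈ i.L6, ∑ x' ∈ i.L6, Real.exp (-(δ₀ * supNorm (x - x'))) * (if x ∈ i.L4 ∧ x' ∉ i.L3 then (1 : ℝ) else 0)
      ≤ Ksum d (δ₀ / 2) * Real.exp (-(δ₀ / 2 * i.r)) * (i.L4.card : ℝ) := by
  have hrow : ∀ x ∈ i.L6, ∑ x' ∈ i.L6, Real.exp (-(δ₀ * supNorm (x - x'))) * (if x ∈ i.L4 ∧ x' ∉ i.L3 then (1 : ℝ) else 0)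
      ≤ if x ∈ i.L4 then Real.exp (-(δ₀ / 2 * i.r)) * Ksum d (δ₀ / 2) else 0 := by
    intro x _
    by_cases hx : x ∈ i.L4
    · rw [if_pos hx]
      have : ∑ x' ∈ i.L6, Real.exp (-(δ₀ * supNorm (x - x'))) * (if x ∈ i.L4 ∧ x' ∉ i.L3 then (1 : ℝ) else 0)
          = ∑ x' ∈ i.L6 with x' ∉ i.L3, Real.exp (-(δ₀ * supNorm (x' - x))) := by
        rw [Finset.sum_filter]
        refine Finset.sum_congr rfl fun x' _ => ?_
        by_cases hx' : x' ∉ i.L3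
        · rw [if_pos ⟨hx, hx'⟩, if_pos hx', mul_one, supNorm_sub_comm]
        · rw [if_neg (fun h => hx' h.2), if_neg hx', mul_zero]
      rw [this]
      exact sum_exp_supNorm_far_le hδ₀ x _ fun x' hx' => by
        rw [Finset.mem_filter] at hx'
        exact hA.sep34 x' hx'.1 hx'.2 x hx
    · rw [if_neg hx]
      refine le_of_eq (Finset.sum_eq_zero fun x' _ => ?_)
      rw [if_neg (fun h => hx h.1), mul_zero]
  refine (Finset.sum_le_sum hrow).trans ?_
  rw [Finset.sum_ite, Finset.sum_const_zero, add_zero, Finset.sum_const, nsmul_eq_mul]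
  have hcard : ((i.L6.filter fun x => x ∈ i.L4).card : ℝ) ≤ i.L4.card := by
    exact_mod_cast Finset.card_le_card fun x hx => (Finset.mem_filter.1 hx).2
  have hpos : 0 ≤ Real.exp (-(δ₀ / 2 * i.r)) * Ksum d (δ₀ / 2) := mul_nonneg (Real.exp_pos _).le (Ksum_nonneg (half_pos hδ₀))
  nlinarith

/-- `T₄`: `e^{−δ₀r}Σ_{x,x′∈Λ₃}e^{−δ₀|x−x′|} ≤ K(δ₀)e^{−δ₀r/2}|Λ₃|`. [cite: Balaban1982Higgs2, (2.108) p.580] -/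
private theorem sum_T4_le {c β e₁ δ₀ : ℝ} {M : ℕ} (i : Inst d aminus aplus) (hA : Adm c β M e₁ i) (hδ₀ : 0 < δ₀) :
    ∑ x ∈ i.L6, ∑ x' ∈ i.L6, Real.exp (-(δ₀ * supNorm (x - x'))) *
        (if x ∈ i.L3 ∧ x' ∈ i.L3 then Real.exp (-(δ₀ * i.r)) else 0)
      ≤ Ksum d δ₀ * Real.exp (-(δ₀ / 2 * i.r)) * (i.L3.card : ℝ) := by
  have hK := Ksum_nonneg (d := d) hδ₀
  have hexp : Real.exp (-(δ₀ * i.r)) ≤ Real.exp (-(δ₀ / 2 * i.r)) :=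
    Real.exp_le_exp.2 (by nlinarith [hA.hr, hδ₀])
  have hrow : ∀ x ∈ i.L6, ∑ x' ∈ i.L6, Real.exp (-(δ₀ * supNorm (x - x'))) *
        (if x ∈ i.L3 ∧ x' ∈ i.L3 then Real.exp (-(δ₀ * i.r)) else 0)
      ≤ if x ∈ i.L3 then Real.exp (-(δ₀ / 2 * i.r)) * Ksum d δ₀ else 0 := by
    intro x _
    by_cases hx : x ∈ i.L3
    · rw [if_pos hx]
      have h1 : ∑ x' ∈ i.L6, Real.exp (-(δ₀ * supNorm (x - x'))) *
            (if x ∈ i.L3 ∧ x' ∈ i.L3 then Real.exp (-(δ₀ * i.r)) else 0)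
          ≤ ∑ x' ∈ i.L6, Real.exp (-(δ₀ * supNorm (x' - x))) * Real.exp (-(δ₀ / 2 * i.r)) := by
        refine Finset.sum_le_sum fun x' _ => ?_
        rw [supNorm_sub_comm]
        refine mul_le_mul_of_nonneg_left ?_ (Real.exp_pos _).le
        split_ifs
        · exact hexp
        · exact (Real.exp_pos _).le
      refine h1.trans ?_
      rw [← Finset.sum_mul, mul_comm]
      exact mul_le_mul_of_nonneg_left (sum_exp_supNorm_le hδ₀ x i.L6) (Real.exp_pos _).le
    · rw [if_neg hx]
      refine le_of_eq (Finset.sum_eq_zero fun x' _ => ?_)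
      rw [if_neg (fun h => hx h.1), mul_zero]
  refine (Finset.sum_le_sum hrow).trans ?_
  rw [Finset.sum_ite, Finset.sum_const_zero, add_zero, Finset.sum_const, nsmul_eq_mul]
  have hcard : ((i.L6.filter fun x => x ∈ i.L3).card : ℝ) ≤ i.L3.card := by
    exact_mod_cast Finset.card_le_card fun x hx => (Finset.mem_filter.1 hx).2
  have hpos : 0 ≤ Real.exp (-(δ₀ / 2 * i.r)) * Ksum d δ₀ := mul_nonneg (Real.exp_pos _).le hK
  nlinarith

/-- **the summed weight**: `Σ_{x,x′∈Λ₆′} e^{−δ₀|x−x′|} w(x,x′) ≤ K₂ e^{−δ₀r/2} |Λ₃^{(k)}|` (using `|Λ₅|, |Λ₄| ≤ |Λ₃|`).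
[cite: Balaban1982Higgs2, (2.108) p.580] -/
theorem sum_weight_le {c β e₁ δ₀ : ℝ} {M : ℕ} (i : Inst d aminus aplus) (hA : Adm c β M e₁ i) (hδ₀ : 0 < δ₀) :
    ∑ x ∈ i.L6, ∑ x' ∈ i.L6, Real.exp (-(δ₀ * supNorm (x - x'))) * weight i δ₀ x x'
      ≤ K2 d δ₀ * Real.exp (-(δ₀ / 2 * i.r)) * (i.L3.card : ℝ) := by
  have h1 := sum_T1_le i hA hδ₀
  have h2 := sum_T2_le i hA hδ₀
  have h3 := sum_T3_le i hA hδ₀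
  have h4 := sum_T4_le i hA hδ₀
  have h54 : (i.L5.card : ℝ) ≤ i.L3.card := by exact_mod_cast Finset.card_le_card (i.h54.trans i.h43)
  have h43 : (i.L4.card : ℝ) ≤ i.L3.card := by exact_mod_cast Finset.card_le_card i.h43
  have hK := Ksum_nonneg (d := d) hδ₀
  have hK' := Ksum_nonneg (d := d) (half_pos hδ₀)
  have hE := (Real.exp_pos (-(δ₀ / 2 * i.r))).le
  have hsplit : ∑ x ∈ i.L6, ∑ x' ∈ i.L6, Real.exp (-(δ₀ * supNorm (x - x'))) * weight i δ₀ x x'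
      = (∑ x ∈ i.L6, ∑ x' ∈ i.L6, Real.exp (-(δ₀ * supNorm (x - x'))) * (if x ∉ i.L4 then G5 i δ₀ x else 0))
        + (∑ x ∈ i.L6, ∑ x' ∈ i.L6, Real.exp (-(δ₀ * supNorm (x - x'))) * (if x ∉ i.L3 ∧ x' ∈ i.L4 then (1 : ℝ) else 0))
        + (∑ x ∈ i.L6, ∑ x' ∈ i.L6, Real.exp (-(δ₀ * supNorm (x - x'))) * (if x ∈ i.L4 ∧ x' ∉ i.L3 then (1 : ℝ) else 0))
        + (∑ x ∈ i.L6, ∑ x' ∈ i.L6, Real.exp (-(δ₀ * supNorm (x - x'))) *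
            (if x ∈ i.L3 ∧ x' ∈ i.L3 then Real.exp (-(δ₀ * i.r)) else 0)) := by
    simp only [weight, mul_add, Finset.sum_add_distrib]
  rw [hsplit]
  have hmain : Ksum d δ₀ * Ksum d (δ₀ / 2) * Real.exp (-(δ₀ / 2 * i.r)) * (i.L5.card : ℝ)
      + Ksum d (δ₀ / 2) * Real.exp (-(δ₀ / 2 * i.r)) * (i.L4.card : ℝ)
      + Ksum d (δ₀ / 2) * Real.exp (-(δ₀ / 2 * i.r)) * (i.L4.card : ℝ)
      + Ksum d δ₀ * Real.exp (-(δ₀ / 2 * i.r)) * (i.L3.card : ℝ)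
      ≤ K2 d δ₀ * Real.exp (-(δ₀ / 2 * i.r)) * (i.L3.card : ℝ) := by
    unfold K2
    nlinarith [mul_nonneg (mul_nonneg hK hK') hE, mul_nonneg hK' hE, mul_nonneg hK hE,
      mul_le_mul_of_nonneg_left h54 (mul_nonneg (mul_nonneg hK hK') hE),
      mul_le_mul_of_nonneg_left h43 (mul_nonneg hK' hE)]
  linarith

end Sums

/-! ## §4 The error term of (2.108): `|⟨Λ₆′φ, H_kΛ₆′φ⟩| ≤ C t² e^{−δ₁r(Lᵏε)} |Λ₃^{(k)}|` for `|φ| ≤ t` on `Λ₆^{(k−1)′}` -/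

section Main

variable {ι : Type} [Fintype ι] [DecidableEq ι] {aminus aplus : ℝ}

/-- `|⟨φ,Kφ⟩| ≤ t²Σ|K|` when `|φ| ≤ t` pointwise. [folklore] -/
private theorem abs_form_le_sq_mul_sum {X : Type} [Fintype X] (K : Matrix X X ℝ) {t : ℝ} (φ : X → ℝ)
    (hφ : ∀ p, |φ p| ≤ t) : |φ ⬝ᵥ (K *ᵥ φ)| ≤ t ^ 2 * ∑ p, ∑ q, |K p q| := by
  rw [Finset.mul_sum]
  refine (Finset.abs_sum_le_sum_abs _ _).trans (Finset.sum_le_sum fun p _ => ?_)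
  rw [Finset.mul_sum, Matrix.mulVec, dotProduct, Finset.mul_sum]
  refine (Finset.abs_sum_le_sum_abs _ _).trans (Finset.sum_le_sum fun q _ => ?_)
  rw [abs_mul, abs_mul]
  have hp := hφ p; have hq := hφ q
  have h0 : 0 ≤ |φ p| := abs_nonneg _
  have h1 : 0 ≤ |φ q| := abs_nonneg _
  have hK := abs_nonneg (K p q)
  calc |φ p| * (|K p q| * |φ q|) = (|φ p| * |φ q|) * |K p q| := by ring
    _ ≤ (t * t) * |K p q| := mul_le_mul_of_nonneg_right (mul_le_mul hp hq h1 (h0.trans hp)) hK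
    _ = t ^ 2 * |K p q| := by ring

omit [DecidableEq ι] in
/-- a sum over `X = Λ₆′ × {1,…,N}` of a function of the label only. [folklore] -/
private theorem sum_prod_label (i : Inst d aminus aplus) (f : (Fin (d + 1) → ℤ) → ℝ) :
    ∑ p : ↥i.L6 × ι, f p.1.1 = (Fintype.card ι : ℝ) * ∑ x ∈ i.L6, f x := by
  rw [Fintype.sum_prod_type]
  simp only [Finset.sum_const, Finset.card_univ, nsmul_eq_mul]
  rw [← Finset.mul_sum, Finset.sum_coe_sort i.L6 f]

/-- **THE ERROR TERM OF (2.108) FOR THE CONCRETE `H_k`** (p. 580: *"+ O((Lᵏε)^κ)|Λ₃^{(k)}|"*, obtained *"using Proposition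
I.2.2 and the restrictions on the fields ψ, φ"*): for `N ≥ 1`, every orthogonal flow with a Lipschitz bound, every window
`0 < a₋ ≤ a₊`, regularity constants `c ≥ 0, β > 0` and big-block size `M` there are `e₁ > 0`, `C ≥ 0`, `δ₁ > 0` such that
for every admissible step and every `φ` on `Λ₆^{(k−1)′} × {1,…,N}` with `|φ| ≤ t` pointwise,
`|⟨Λ₆′φ, H_kΛ₆′φ⟩| ≤ C·t²·e^{−δ₁r}·|Λ₃^{(k)}|` (`δ₁ = δ₀/2`, `C = c₀e^{2δ₀}N²K₂(δ₀)`).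
[cite: Balaban1982Higgs2, (2.108) p.580] -/
theorem abs_form_hk_le [Nonempty ι] (F : OrthFlow ι) {ℓ : ℝ} (hℓ : 0 ≤ ℓ)
    (hLip : ∀ t (v : ι → ℝ), ((F.U t - 1) *ᵥ v) ⬝ᵥ ((F.U t - 1) *ᵥ v) ≤ (ℓ * t) ^ 2 * (v ⬝ᵥ v))
    (ham : 0 < aminus) (hle : aminus ≤ aplus) {c : ℝ} (hc : 0 ≤ c) {β : ℝ} (hβ : 0 < β) (M : ℕ) :
    ∃ e₁ C δ₁ : ℝ, 0 < e₁ ∧ 0 ≤ C ∧ 0 < δ₁ ∧ ∀ i : Inst d aminus aplus, Adm c β M e₁ i →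
      ∀ (t : ℝ) (φ : ↥i.L6 × ι → ℝ), (∀ p, |φ p| ≤ t) →
        |φ ⬝ᵥ (i.Hk F *ᵥ φ)| ≤ C * t ^ 2 * Real.exp (-(δ₁ * i.r)) * (i.L3.card : ℝ) := by
  obtain ⟨δ₀, c₀, e₁, hδ₀, hc₀, he₁, H⟩ := prop22Small_regularPairW (d := d) F hℓ hLip ham hle hc hβ M
  have hK2 := K2_nonneg (d := d) hδ₀
  refine ⟨e₁, c₀ * Real.exp (2 * δ₀) * (Fintype.card ι : ℝ) ^ 2 * K2 d δ₀, δ₀ / 2, he₁, by positivity, by positivity, ?_⟩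
  intro i hA t φ hφ
  have I0 : B1.Ineq227_229 (regDict F (ham.trans_le i.pair0.hak) c β M i.pair0.toRegularPairInstance).toDelta δ₀ c₀ :=
    H i.pair0 hA.reg ⟨hA.blkΩ, hA.blkΩ⟩ hA.he hA.he1
  have I1 : B1.Ineq227_229 (regDict F (ham.trans_le i.pair1.hak) c β M i.pair1.toRegularPairInstance).toDelta δ₀ c₀ :=
    H i.pair1 hA.reg ⟨hA.blk1, hA.blkΩ⟩ hA.he hA.he1
  have I2 : B1.Ineq227_229 (regDict F (ham.trans_le i.pair2.hak) c β M i.pair2.toRegularPairInstance).toDelta δ₀ c₀ :=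
    H i.pair2 hA.reg ⟨hA.blk2, hA.blkΩ⟩ hA.he hA.he1
  have hpt := abs_hk_le_weight F i hA hδ₀ hc₀.le
    (fun y y' l l' => abs_deltaK_entry_le F _ c β M _ I0 y y' l l')
    (fun y y' l l' => abs_deltaK_entry_sub_le F _ c β M _ I1 y y' l l')
    (fun y y' l l' => abs_deltaK_entry_sub_le F _ c β M _ I2 y y' l l')
  -- |form| ≤ t² Σ|h| ≤ t² c₀e^{2δ₀} Σ e^{−δ₀D} w ≤ …
  have hsum : ∑ p : ↥i.L6 × ι, ∑ q : ↥i.L6 × ι, |i.Hk F p q|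
      ≤ c₀ * Real.exp (2 * δ₀) * (Fintype.card ι : ℝ) ^ 2 *
          ∑ x ∈ i.L6, ∑ x' ∈ i.L6, Real.exp (-(δ₀ * supNorm (x - x'))) * weight i δ₀ x x' := by
    calc ∑ p : ↥i.L6 × ι, ∑ q : ↥i.L6 × ι, |i.Hk F p q|
        ≤ ∑ p : ↥i.L6 × ι, ∑ q : ↥i.L6 × ι,
            c₀ * Real.exp (2 * δ₀) * Real.exp (-(δ₀ * supNorm (p.1.1 - q.1.1))) * weight i δ₀ p.1.1 q.1.1 :=
          Finset.sum_le_sum fun p _ => Finset.sum_le_sum fun q _ => hpt p q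
      _ = c₀ * Real.exp (2 * δ₀) * (Fintype.card ι : ℝ) ^ 2 *
          ∑ x ∈ i.L6, ∑ x' ∈ i.L6, Real.exp (-(δ₀ * supNorm (x - x'))) * weight i δ₀ x x' := by
          have inner : ∀ p : ↥i.L6 × ι, ∑ q : ↥i.L6 × ι,
              c₀ * Real.exp (2 * δ₀) * Real.exp (-(δ₀ * supNorm (p.1.1 - q.1.1))) * weight i δ₀ p.1.1 q.1.1
              = (Fintype.card ι : ℝ) * ∑ x' ∈ i.L6,
                  c₀ * Real.exp (2 * δ₀) * Real.exp (-(δ₀ * supNorm (p.1.1 - x'))) * weight i δ₀ p.1.1 x' :=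
            fun p => sum_prod_label i (fun x' =>
              c₀ * Real.exp (2 * δ₀) * Real.exp (-(δ₀ * supNorm (p.1.1 - x'))) * weight i δ₀ p.1.1 x')
          simp_rw [inner]
          rw [← Finset.mul_sum, sum_prod_label i (fun x => ∑ x' ∈ i.L6,
            c₀ * Real.exp (2 * δ₀) * Real.exp (-(δ₀ * supNorm (x - x'))) * weight i δ₀ x x')]
          simp only [Finset.mul_sum]
          refine Finset.sum_congr rfl fun x _ => Finset.sum_congr rfl fun x' _ => ?_
          ring
  have hW := sum_weight_le i hA hδ₀
  have hform := abs_form_le_sq_mul_sum (i.Hk F) φ hφ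
  have ht2 : 0 ≤ t ^ 2 := sq_nonneg t
  have hpre : 0 ≤ c₀ * Real.exp (2 * δ₀) * (Fintype.card ι : ℝ) ^ 2 := by positivity
  calc |φ ⬝ᵥ (i.Hk F *ᵥ φ)| ≤ t ^ 2 * ∑ p, ∑ q, |i.Hk F p q| := hform
    _ ≤ t ^ 2 * (c₀ * Real.exp (2 * δ₀) * (Fintype.card ι : ℝ) ^ 2 *
          (K2 d δ₀ * Real.exp (-(δ₀ / 2 * i.r)) * (i.L3.card : ℝ))) :=
        mul_le_mul_of_nonneg_left (hsum.trans (mul_le_mul_of_nonneg_left hW hpre)) ht2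
    _ = c₀ * Real.exp (2 * δ₀) * (Fintype.card ι : ℝ) ^ 2 * K2 d δ₀ * t ^ 2 * Real.exp (-(δ₀ / 2 * i.r)) *
          (i.L3.card : ℝ) := by ring

/-- **«O((Lᵏε)^κ)|Λ₃^{(k)}|» FOR ARBITRARY `κ`**: with `r = r(Lᵏε)` of (2.7) in the printed ranges and a field threshold of
polynomial growth `t ≤ T·(Lᵏε)^{−m}` (the restrictions on `φ`: `|φ| ≤ c₁λ(L^{k−1}ε)^{−1/4}p(L^{k−1}ε)`, polynomial × logarithmic
in `(Lᵏε)^{−1}`), the error term is `≤ C′(Lᵏε)^κ|Λ₃^{(k)}|` for every `κ` (r14's `B2StepK.rDecayBeatsPowers_of_printed`).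
[cite: Balaban1982Higgs2, (2.108) p.580, (2.7) p.558, (2.55) p.570] -/
theorem abs_form_hk_le_pow [Nonempty ι] (F : OrthFlow ι) {ℓ : ℝ} (hℓ : 0 ≤ ℓ)
    (hLip : ∀ t (v : ι → ℝ), ((F.U t - 1) *ᵥ v) ⬝ᵥ ((F.U t - 1) *ᵥ v) ≤ (ℓ * t) ^ 2 * (v ⬝ᵥ v))
    (ham : 0 < aminus) (hle : aminus ≤ aplus) {c : ℝ} (hc : 0 ≤ c) {β : ℝ} (hβ : 0 < β) (M : ℕ)
    (P : B2.Params) (hP : P.Printed) {T : ℝ} (hT : 0 ≤ T) (m κ : ℝ) :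
    ∃ e₁ C' : ℝ, 0 < e₁ ∧ ∀ i : Inst d aminus aplus, Adm c β M e₁ i → ∀ scale : ℝ, 0 < scale → scale ≤ 1 →
      i.r = B2.rFn P.R P.r scale → ∀ (t : ℝ) (φ : ↥i.L6 × ι → ℝ), 0 ≤ t → t ≤ T * scale ^ (-m) → (∀ p, |φ p| ≤ t) →
        |φ ⬝ᵥ (i.Hk F *ᵥ φ)| ≤ C' * scale ^ κ * (i.L3.card : ℝ) := by
  obtain ⟨e₁, C, δ₁, he₁, hC, hδ₁, h⟩ := abs_form_hk_le (d := d) F hℓ hLip ham hle hc hβ M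
  obtain ⟨Cκ, hCκ⟩ := B2StepK.rDecayBeatsPowers_of_printed P hP hδ₁ (κ + 2 * m)
  refine ⟨e₁, C * T ^ 2 * Cκ, he₁, fun i hA scale hs hs1 hr t φ ht htT hφ => ?_⟩
  have h1 := h i hA t φ hφ
  have h2 := hCκ scale hs hs1
  rw [← hr] at h2
  have hCκ0 : 0 ≤ Cκ := by
    have := (Real.exp_pos (-(δ₁ * i.r))).le.trans h2
    have hsp : 0 < scale ^ (κ + 2 * m) := Real.rpow_pos_of_pos hs _
    nlinarith
  have ht2 : t ^ 2 ≤ T ^ 2 * scale ^ (-(2 * m)) := by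
    have hsm : 0 ≤ T * scale ^ (-m) := mul_nonneg hT (Real.rpow_nonneg hs.le _)
    have := pow_le_pow_left₀ ht htT 2
    calc t ^ 2 ≤ (T * scale ^ (-m)) ^ 2 := this
      _ = T ^ 2 * scale ^ (-(2 * m)) := by
          rw [mul_pow]
          congr 1
          rw [← Real.rpow_natCast (scale ^ (-m)) 2, ← Real.rpow_mul hs.le]
          congr 1
          push_cast
          ring
  have hL3 : 0 ≤ (i.L3.card : ℝ) := Nat.cast_nonneg _
  have hpow : scale ^ (-(2 * m)) * scale ^ (κ + 2 * m) = scale ^ κ := by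
    rw [← Real.rpow_add hs]; ring_nf
  calc |φ ⬝ᵥ (i.Hk F *ᵥ φ)| ≤ C * t ^ 2 * Real.exp (-(δ₁ * i.r)) * (i.L3.card : ℝ) := h1
    _ ≤ C * (T ^ 2 * scale ^ (-(2 * m))) * (Cκ * scale ^ (κ + 2 * m)) * (i.L3.card : ℝ) := by
        have e0 := (Real.exp_pos (-(δ₁ * i.r))).le
        have s0 : 0 ≤ T ^ 2 * scale ^ (-(2 * m)) := mul_nonneg (sq_nonneg T) (Real.rpow_nonneg hs.le _)
        refine mul_le_mul_of_nonneg_right ?_ hL3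
        calc C * t ^ 2 * Real.exp (-(δ₁ * i.r)) ≤ C * (T ^ 2 * scale ^ (-(2 * m))) * Real.exp (-(δ₁ * i.r)) :=
              mul_le_mul_of_nonneg_right (mul_le_mul_of_nonneg_left ht2 hC) e0
          _ ≤ C * (T ^ 2 * scale ^ (-(2 * m))) * (Cκ * scale ^ (κ + 2 * m)) :=
              mul_le_mul_of_nonneg_left h2 (mul_nonneg hC s0)
    _ = C * T ^ 2 * Cκ * (scale ^ (-(2 * m)) * scale ^ (κ + 2 * m)) * (i.L3.card : ℝ) := by ring
    _ = C * T ^ 2 * Cκ * scale ^ κ * (i.L3.card : ℝ) := by rw [hpow]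

end Main

/-! ## §5 The printed field restriction is a polynomial threshold (HONEST SCOPE (b) of v1 spelled out)

(2.55) p. 570: on `Λ₋₁^{(k−1)′} ⊃ Λ₆^{(k−1)′}` the characteristic functions `χ_k` restrict `|φ| ≤ c₁λ(L^{k−1}ε)^{−1/4}p(L^{k−1}ε)` with
`p(ε) = b₀(1 + log ε⁻¹)^p` (p. 557).  Since `1 ≤ 1 + log x⁻¹ ≤ x⁻¹` on `(0,1]`, `p(x) ≤ b₀x^{−p}`, so with `ℓ = Lᵏε ∈ (0,1]`,
`L^{k−1}ε = ℓ/L`: `c₁λ(ℓ/L)^{−1/4}p(ℓ/L) ≤ (c₁λ·b₀·L^{1/4+p})·ℓ^{−(1/4+p)}` — the shape `T·ℓ^{−m}` of `abs_form_hk_le_pow`. -/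

section Printed

variable {ι : Type} [Fintype ι] [DecidableEq ι] {aminus aplus : ℝ}

/-- `1 + log x⁻¹ ≤ x⁻¹` for `x > 0` (`log y ≤ y − 1`). [folklore] -/
private theorem one_add_log_inv_le {x : ℝ} (hx : 0 < x) : 1 + Real.log x⁻¹ ≤ x⁻¹ := by
  have := Real.log_le_sub_one_of_pos (inv_pos.2 hx)
  linarith

/-- `1 ≤ 1 + log x⁻¹` for `0 < x ≤ 1`. [folklore] -/
private theorem one_le_one_add_log_inv {x : ℝ} (hx : 0 < x) (hx1 : x ≤ 1) : 1 ≤ 1 + Real.log x⁻¹ := by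
  have : 0 ≤ Real.log x⁻¹ := Real.log_nonneg ((one_le_inv₀ hx).2 hx1)
  linarith

/-- `p(x) ≤ b₀x^{−p}` on `(0,1]` for `b₀, p ≥ 0`. [cite: Balaban1982Higgs2, p.557] -/
theorem pFn_le_rpow {b₀ p x : ℝ} (hb : 0 ≤ b₀) (hp : 0 ≤ p) (hx : 0 < x) (hx1 : x ≤ 1) :
    B2.pFn b₀ p x ≤ b₀ * x ^ (-p) := by
  unfold B2.pFn
  refine mul_le_mul_of_nonneg_left ?_ hb
  rw [Real.rpow_neg hx.le, ← Real.inv_rpow hx.le]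
  exact Real.rpow_le_rpow (by linarith [one_le_one_add_log_inv hx hx1]) (one_add_log_inv_le hx) hp

/-- the printed threshold is polynomial: `c(ℓ/L)^{−1/4}p(ℓ/L) ≤ (c·b₀·L^{1/4+p})·ℓ^{−(1/4+p)}` for `c, b₀, p ≥ 0`, `L ≥ 1`,
`ℓ ∈ (0,1]`. [cite: Balaban1982Higgs2, (2.55) p.570, p.557] -/
theorem printedThreshold_le {c b₀ p L ℓ : ℝ} (hc : 0 ≤ c) (hb : 0 ≤ b₀) (hp : 0 ≤ p) (hL : 1 ≤ L) (hℓ : 0 < ℓ)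
    (hℓ1 : ℓ ≤ 1) :
    c * (ℓ / L) ^ (-(1 / 4 : ℝ)) * B2.pFn b₀ p (ℓ / L) ≤ (c * b₀ * L ^ (1 / 4 + p)) * ℓ ^ (-(1 / 4 + p)) := by
  have hL0 : 0 < L := by linarith
  have hx : 0 < ℓ / L := div_pos hℓ hL0
  have hx1 : ℓ / L ≤ 1 := by rw [div_le_one hL0]; linarith
  have h1 := pFn_le_rpow hb hp hx hx1
  have h2 : 0 ≤ (ℓ / L) ^ (-(1 / 4 : ℝ)) := Real.rpow_nonneg hx.le _
  calc c * (ℓ / L) ^ (-(1 / 4 : ℝ)) * B2.pFn b₀ p (ℓ / L) ≤ c * (ℓ / L) ^ (-(1 / 4 : ℝ)) * (b₀ * (ℓ / L) ^ (-p)) :=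
        mul_le_mul_of_nonneg_left h1 (mul_nonneg hc h2)
    _ = c * b₀ * ((ℓ / L) ^ (-(1 / 4 : ℝ)) * (ℓ / L) ^ (-p)) := by ring
    _ = c * b₀ * (ℓ / L) ^ (-(1 / 4 + p)) := by rw [← Real.rpow_add hx]; congr 1; ring
    _ = c * b₀ * (L ^ (1 / 4 + p) * ℓ ^ (-(1 / 4 + p))) := by
        congr 1
        rw [Real.div_rpow hℓ.le hL0.le, Real.rpow_neg hL0.le (1 / 4 + p), div_inv_eq_mul, mul_comm]
    _ = (c * b₀ * L ^ (1 / 4 + p)) * ℓ ^ (-(1 / 4 + p)) := by ring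

/-- **THE ERROR TERM UNDER THE PRINTED RESTRICTION**: with `r = r(Lᵏε)` and `p(·)` of the printed ranges
(`B2.Params.Printed`: `p > 2`, `r > 1`, `L > 1`, `b₀ > 0`, `R > 0`), `ℓ = Lᵏε ∈ (0,1]`, any `c₁λ ≥ 0` (`cl`), and
`|φ| ≤ c₁λ(L^{k−1}ε)^{−1/4}p(L^{k−1}ε)` on `Λ₆^{(k−1)′}` (`L^{k−1}ε = ℓ/L`): for every `κ` there is `C′` with
`|⟨Λ₆′φ, H_kΛ₆′φ⟩| ≤ C′(Lᵏε)^κ|Λ₃^{(k)}|` for every admissible step — the printed *"+ O((Lᵏε)^κ)|Λ₃^{(k)}|"* of (2.108) with the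
printed restriction on `φ`. [cite: Balaban1982Higgs2, (2.108) p.580, (2.55) p.570] -/
theorem abs_form_hk_le_printed [Nonempty ι] (F : OrthFlow ι) {ℓ : ℝ} (hℓ : 0 ≤ ℓ)
    (hLip : ∀ t (v : ι → ℝ), ((F.U t - 1) *ᵥ v) ⬝ᵥ ((F.U t - 1) *ᵥ v) ≤ (ℓ * t) ^ 2 * (v ⬝ᵥ v))
    (ham : 0 < aminus) (hle : aminus ≤ aplus) {c : ℝ} (hc : 0 ≤ c) {β : ℝ} (hβ : 0 < β) (M : ℕ)
    (P : B2.Params) (hP : P.Printed) {cl : ℝ} (hcl : 0 ≤ cl) (κ : ℝ) :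
    ∃ e₁ C' : ℝ, 0 < e₁ ∧ ∀ i : Inst d aminus aplus, Adm c β M e₁ i → ∀ scale : ℝ, 0 < scale → scale ≤ 1 →
      i.r = B2.rFn P.R P.r scale → ∀ (φ : ↥i.L6 × ι → ℝ),
        (∀ p, |φ p| ≤ cl * (scale / P.L) ^ (-(1 / 4 : ℝ)) * B2.pFn P.b₀ P.p (scale / P.L)) →
        |φ ⬝ᵥ (i.Hk F *ᵥ φ)| ≤ C' * scale ^ κ * (i.L3.card : ℝ) := by
  obtain ⟨hp2, -, hL1, -, -, -, hb0, -⟩ := id hP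
  have hT : 0 ≤ cl * P.b₀ * (P.L : ℝ) ^ (1 / 4 + P.p) :=
    mul_nonneg (mul_nonneg hcl hb0.le) (Real.rpow_nonneg (Nat.cast_nonneg _) _)
  obtain ⟨e₁, C', he₁, h⟩ := abs_form_hk_le_pow (d := d) F hℓ hLip ham hle hc hβ M P hP hT (1 / 4 + P.p) κ
  refine ⟨e₁, C', he₁, fun i hA scale hs hs1 hr φ hφ => ?_⟩
  have hL : (1 : ℝ) ≤ P.L := by exact_mod_cast hL1.le
  have ht0 : 0 ≤ cl * (scale / P.L) ^ (-(1 / 4 : ℝ)) * B2.pFn P.b₀ P.p (scale / P.L) := by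
    have hx : 0 < scale / P.L := div_pos hs (by linarith)
    have : 0 ≤ B2.pFn P.b₀ P.p (scale / P.L) := by
      unfold B2.pFn
      exact mul_nonneg hb0.le (Real.rpow_nonneg (by
        linarith [one_le_one_add_log_inv hx (by rw [div_le_one (by linarith)]; linarith)]) _)
    exact mul_nonneg (mul_nonneg hcl (Real.rpow_nonneg hx.le _)) this
  exact h i hA scale hs hs1 hr _ φ ht0 (printedThreshold_le hcl hb0.le (by linarith) hL hs hs1) hφ

end Printed

/-! ## §6 (v1.3) The printed restriction (2.55)₄ with `λ(·)` the FUNCTION of p. 557 — every `d`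

Second-reader note S-B2-r14g16-1 (r14 gen 16, SECONDREAD-B2 v41).  (2.55)₄ p. 570 reads «|φ(x)| ≤ (c₁/λ(L^{k−1}ε)^{1/4})
p(L^{k−1}ε) for x ∈ Λ₋₁^{(k−1)′}», and `λ(·)` is the function of p. 557 last line «where λ(ε) = λε^{4−d}» ((2.2): «|φ(x)| >
(1/(λε^{4−d})^{1/4})p(ε)»; (2.5): «|φ(x)| ≤ (1/λ(ε)^{1/4})p(ε)»).  Hence the threshold is `c₁λ^{−1/4}(L^{k−1}ε)^{−(4−d)/4}
p(L^{k−1}ε)` — the typer's `c₁·thrPhi λ (L^{k−1}ε) d (p(L^{k−1}ε))` (`B2LargeField.thrPhi lam ε d pε = pε/λ(ε)^{1/4}`,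
`lambdaEps lam ε d = λε^{4−d}`); §5's `cl·(ℓ/L)^{−1/4}p(ℓ/L)` is its `d = 3` normal form (`cl = c₁λ^{−1/4}`), while at `d = 2`
the exponent is `1/2`.  The conclusion of `abs_form_hk_le_printed` holds VERBATIM under the printed threshold for every `d`, by
§4's `abs_form_hk_le_pow` with `T = c₁λ^{−1/4}b₀L^{(4−d)/4+p}`, `m = (4−d)/4 + p` (same proof, one exponent renamed). -/

section PrintedGeneral

variable {ι : Type} [Fintype ι] [DecidableEq ι] {aminus aplus : ℝ}

/-- a threshold of polynomial × logarithmic shape with ANY exponent is polynomial: `c(ℓ/L)^{−q}p(ℓ/L) ≤ (c·b₀·L^{q+p})·ℓ^{−(q+p)}`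
for `c, b₀, p ≥ 0`, `L ≥ 1`, `ℓ ∈ (0,1]`, every real `q` (§5's `printedThreshold_le` is `q = 1/4`).
[cite: Balaban1982Higgs2, (2.55) p.570, p.557] -/
theorem printedThreshold_rpow_le {c b₀ p L ℓ : ℝ} (q : ℝ) (hc : 0 ≤ c) (hb : 0 ≤ b₀) (hp : 0 ≤ p) (hL : 1 ≤ L)
    (hℓ : 0 < ℓ) (hℓ1 : ℓ ≤ 1) :
    c * (ℓ / L) ^ (-q) * B2.pFn b₀ p (ℓ / L) ≤ (c * b₀ * L ^ (q + p)) * ℓ ^ (-(q + p)) := by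
  have hL0 : 0 < L := by linarith
  have hx : 0 < ℓ / L := div_pos hℓ hL0
  have hx1 : ℓ / L ≤ 1 := by rw [div_le_one hL0]; linarith
  have h1 := pFn_le_rpow hb hp hx hx1
  have h2 : 0 ≤ (ℓ / L) ^ (-q) := Real.rpow_nonneg hx.le _
  calc c * (ℓ / L) ^ (-q) * B2.pFn b₀ p (ℓ / L) ≤ c * (ℓ / L) ^ (-q) * (b₀ * (ℓ / L) ^ (-p)) :=
        mul_le_mul_of_nonneg_left h1 (mul_nonneg hc h2)
    _ = c * b₀ * ((ℓ / L) ^ (-q) * (ℓ / L) ^ (-p)) := by ring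
    _ = c * b₀ * (ℓ / L) ^ (-(q + p)) := by rw [← Real.rpow_add hx]; congr 1; ring
    _ = c * b₀ * (L ^ (q + p) * ℓ ^ (-(q + p))) := by
        congr 1
        rw [Real.div_rpow hℓ.le hL0.le, Real.rpow_neg hL0.le (q + p), div_inv_eq_mul, mul_comm]
    _ = (c * b₀ * L ^ (q + p)) * ℓ ^ (-(q + p)) := by ring

/-- the printed threshold of (2.55)₄ / (2.2) in power form: `c₁·p(x)/λ(x)^{1/4} = (c₁λ^{−1/4})·x^{−(4−d)/4}·p(x)` with
`λ(x) = λx^{4−d}` (typer's `B2LargeField.lambdaEps`; the threshold `p(x)/λ(x)^{1/4}` is `B2LargeField.thrPhi`), for `λ > 0`,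
`x > 0` (cf. p15's `B2Eq2112Replacement.two_thrPhi_pFn_eq`, the `c₁ = 2` instance, proved the same way).
[cite: Balaban1982Higgs2, (2.2)/(2.5) p.557, (2.55) p.570] -/
theorem thrPhi_pFn_eq {lam x b₀ p : ℝ} (c₁ : ℝ) (hlam : 0 < lam) (hx : 0 < x) (d : ℕ) :
    c₁ * B2LargeField.thrPhi lam x d (B2.pFn b₀ p x)
      = (c₁ * lam ^ (-(1 / 4 : ℝ))) * x ^ (-(((4 : ℝ) - d) / 4)) * B2.pFn b₀ p x := by
  unfold B2LargeField.thrPhi B2LargeField.lambdaEps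
  have hz : x ^ ((4 : ℤ) - d) = x ^ ((4 : ℝ) - d) := by
    rw [← Real.rpow_intCast]
    push_cast
    ring_nf
  rw [hz, Real.mul_rpow hlam.le (Real.rpow_nonneg hx.le _), ← Real.rpow_mul hx.le]
  have h1 : lam ^ (-(1 / 4 : ℝ)) = (lam ^ (1 / 4 : ℝ))⁻¹ := Real.rpow_neg hlam.le _
  have h2 : x ^ (-(((4 : ℝ) - d) / 4)) = (x ^ (((4 : ℝ) - d) * (1 / 4)))⁻¹ := by
    rw [← Real.rpow_neg hx.le]
    congr 1
    ring
  rw [h1, h2]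
  have h3 : 0 < lam ^ (1 / 4 : ℝ) := Real.rpow_pos_of_pos hlam _
  have h4 : 0 < x ^ (((4 : ℝ) - d) * (1 / 4)) := Real.rpow_pos_of_pos hx _
  field_simp

/-- the printed threshold is nonnegative on `(0,1]` (`λ > 0`, `c₁, b₀ ≥ 0`). [cite: Balaban1982Higgs2, (2.55) p.570, p.557] -/
theorem thrPhi_pFn_nonneg {lam c₁ b₀ p x : ℝ} (hlam : 0 < lam) (hc : 0 ≤ c₁) (hb : 0 ≤ b₀) (hx : 0 < x) (hx1 : x ≤ 1)
    (d : ℕ) : 0 ≤ c₁ * B2LargeField.thrPhi lam x d (B2.pFn b₀ p x) := by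
  unfold B2LargeField.thrPhi
  refine mul_nonneg hc (div_nonneg ?_ (Real.rpow_nonneg (B2LargeField.lambdaEps_pos hlam hx d).le _))
  unfold B2.pFn
  exact mul_nonneg hb (Real.rpow_nonneg (by linarith [one_le_one_add_log_inv hx hx1]) _)

/-- the PRINTED threshold of (2.55)₄ is polynomial for every `d`: with `ℓ = Lᵏε ∈ (0,1]`, `L ≥ 1`, `λ > 0`, `c₁, b₀, p ≥ 0`,
`c₁p(ℓ/L)/λ(ℓ/L)^{1/4} ≤ (c₁λ^{−1/4}b₀L^{(4−d)/4+p})·ℓ^{−((4−d)/4+p)}` — the shape `T·ℓ^{−m}` of §4's `abs_form_hk_le_pow`.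
[cite: Balaban1982Higgs2, (2.55) p.570, p.557] -/
theorem printedThreshold_thrPhi_le {lam c₁ b₀ p L ℓ : ℝ} (hlam : 0 < lam) (hc : 0 ≤ c₁) (hb : 0 ≤ b₀) (hp : 0 ≤ p)
    (hL : 1 ≤ L) (hℓ : 0 < ℓ) (hℓ1 : ℓ ≤ 1) (d : ℕ) :
    c₁ * B2LargeField.thrPhi lam (ℓ / L) d (B2.pFn b₀ p (ℓ / L))
      ≤ (c₁ * lam ^ (-(1 / 4 : ℝ)) * b₀ * L ^ (((4 : ℝ) - d) / 4 + p)) * ℓ ^ (-(((4 : ℝ) - d) / 4 + p)) := by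
  have hL0 : 0 < L := by linarith
  rw [thrPhi_pFn_eq c₁ hlam (div_pos hℓ hL0) d]
  exact printedThreshold_rpow_le _ (mul_nonneg hc (Real.rpow_nonneg hlam.le _)) hb hp hL hℓ hℓ1

/-- **THE ERROR TERM UNDER THE PRINTED RESTRICTION (2.55)₄, FOR EVERY `d`**: with `r = r(Lᵏε)` and `p(·)` of the printed
ranges (`B2.Params.Printed`), `ℓ = Lᵏε ∈ (0,1]`, `λ > 0`, `c₁ ≥ 0`, and `|φ(x)| ≤ (c₁/λ(L^{k−1}ε)^{1/4})p(L^{k−1}ε)` on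
`Λ₆^{(k−1)′}` with `λ(ε) = λε^{4−d}` (typer's `B2LargeField.thrPhi λ (ℓ/L) d (p(ℓ/L))`, `d = P.d`, `L^{k−1}ε = ℓ/L`): for every
`κ` there is `C′` with `|⟨Λ₆′φ, H_kΛ₆′φ⟩| ≤ C′(Lᵏε)^κ|Λ₃^{(k)}|` for every admissible step — the printed *"+ O((Lᵏε)^κ)|Λ₃^{(k)}|"*
of (2.108) under the restriction AS PRINTED (§5's `abs_form_hk_le_printed` is the `d = 3` normal form; at `d = 2` the
exponent is `1/2`). [cite: Balaban1982Higgs2, (2.108) p.580, (2.55) p.570, (2.2)/(2.5) p.557] -/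
theorem abs_form_hk_le_printed' [Nonempty ι] (F : OrthFlow ι) {ℓ : ℝ} (hℓ : 0 ≤ ℓ)
    (hLip : ∀ t (v : ι → ℝ), ((F.U t - 1) *ᵥ v) ⬝ᵥ ((F.U t - 1) *ᵥ v) ≤ (ℓ * t) ^ 2 * (v ⬝ᵥ v))
    (ham : 0 < aminus) (hle : aminus ≤ aplus) {c : ℝ} (hc : 0 ≤ c) {β : ℝ} (hβ : 0 < β) (M : ℕ)
    (P : B2.Params) (hP : P.Printed) {lam c₁ : ℝ} (hlam : 0 < lam) (hc₁ : 0 ≤ c₁) (κ : ℝ) :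
    ∃ e₁ C' : ℝ, 0 < e₁ ∧ ∀ i : Inst d aminus aplus, Adm c β M e₁ i → ∀ scale : ℝ, 0 < scale → scale ≤ 1 →
      i.r = B2.rFn P.R P.r scale → ∀ (φ : ↥i.L6 × ι → ℝ),
        (∀ p, |φ p| ≤ c₁ * B2LargeField.thrPhi lam (scale / P.L) P.d (B2.pFn P.b₀ P.p (scale / P.L))) →
        |φ ⬝ᵥ (i.Hk F *ᵥ φ)| ≤ C' * scale ^ κ * (i.L3.card : ℝ) := by
  obtain ⟨hp2, -, hL1, -, -, -, hb0, -⟩ := id hP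
  have hT : 0 ≤ c₁ * lam ^ (-(1 / 4 : ℝ)) * P.b₀ * (P.L : ℝ) ^ (((4 : ℝ) - P.d) / 4 + P.p) :=
    mul_nonneg (mul_nonneg (mul_nonneg hc₁ (Real.rpow_nonneg hlam.le _)) hb0.le)
      (Real.rpow_nonneg (Nat.cast_nonneg _) _)
  obtain ⟨e₁, C', he₁, h⟩ :=
    abs_form_hk_le_pow (d := d) F hℓ hLip ham hle hc hβ M P hP hT (((4 : ℝ) - P.d) / 4 + P.p) κ
  refine ⟨e₁, C', he₁, fun i hA scale hs hs1 hr φ hφ => ?_⟩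
  have hL : (1 : ℝ) ≤ P.L := by exact_mod_cast hL1.le
  have hx1 : scale / P.L ≤ 1 := by rw [div_le_one (by linarith)]; linarith
  exact h i hA scale hs hs1 hr _ φ (thrPhi_pFn_nonneg hlam hc₁ hb0.le (div_pos hs (by linarith)) hx1 P.d)
    (printedThreshold_thrPhi_le hlam hc₁ hb0.le (by linarith) hL hs hs1 P.d) hφ

end PrintedGeneral

end

end Literature.MathematicalPhysics.QuantumFieldTheory.Balaban1983to89.B2Eq2108ErrorBound
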